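import Mathlib.CategoryTheory.Groupoid
import Mathlib.CategoryTheory.Functor.FullyFaithful
import Mathlib.CategoryTheory.NatIso
import Mathlib.Data.Set.Image
import Mathlib.Logic.Function.Basic
import Literature.IUT.LogThetaLattice.PrimeStripFrame
import Literature.IUT.LogThetaLattice.LogLink
import HarnessLib

/-!
# [IUTchIII] Proposition 1.3, Definition 1.4, Theorem 1.5 (i)(ii): log-links of Hodge theaters and the log-theta-lattice

Mochizuki, *Inter-universal Teichmüller Theory III*, kurims manuscript (May 2020), §1
[cite: Mochizuki2012, III Prop 1.3 pp.41–43; Rmk 1.3.1 p.43; Def 1.4 pp.45–46; Thm 1.5 (i)(ii) p.48]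
(D-0012 claim key, status disputed; typed over the interface `StripFrame`, nothing asserted).

Printed text.
* Prop 1.3 (i) p.42 (Construction of the log-Link): "Fix an isomorphism `Ξ : †HT^{D-Θ±ell NF} ⥲
  ‡HT^{D-Θ±ell NF}` of `D-Θ^{±ell}NF`-Hodge theaters. Let `†F_□` be one of the `F`-prime-strips that
  appear in the Θ- and Θ^±-bridges that constitute `†HT^{Θ±ell NF}` — i.e., either one of `†F_>`,
  `†F_≻` or one of the constituent `F`-prime-strips of the capsules `†F_J`, `†F_T` … Write `‡F_□` for
  the corresponding `F`-prime-strip of `‡HT`. Then the poly-isomorphism determined by `Ξ` between the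
  `D`-prime-strips associated to `†F_□`, `‡F_□` uniquely determines a poly-isomorphism
  `log(†F_□) ⥲ ‡F_□` [cf. Definition 1.1, (iii); [IUTchI], Corollary 5.3, (ii)], hence a log-link
  `†F_□ --log--> ‡F_□` … We shall … refer to as a log-link from `†HT` to `‡HT` the collection of data
  consisting of `Ξ`, together with the collection of log-links `†F_□ --log--> ‡F_□`, as "`□`" ranges
  over all possibilities … When `Ξ` is replaced by a poly-isomorphism … [the collection] corresponding
  to each constituent isomorphism of the poly-isomorphism `Ξ` … When `Ξ` is the full
  poly-isomorphism, we shall refer to the resulting log-link as the full log-link."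
* Rmk 1.3.1 p.43: "it was necessary to carry out the given construction of the log-link first for a
  single `Ξ` [i.e., as opposed to a poly-isomorphism `Ξ`], in order to maintain compatibility with
  the crucial "±-synchronization"" — reflected below: `stripLogIso` takes ONE `ξ`, and the
  poly-version is the image over the constituents of `Ξ`.
* Prop 1.3 (ii) p.42 (Coricity): "Any log-link `†HT --log--> ‡HT` induces [and may be thought of as
  "lying over"] a [poly-]isomorphism `†HT^D ⥲ ‡HT^D` … [and indeed coincides with the log-link
  constructed in (i) from this [poly-]isomorphism …]."
* Prop 1.3 (iv) p.43 (Frobenius-picture): distinct `{ⁿHT}_{n∈ℤ}`; the full log-links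
  `ⁿHT --log--> ⁿ⁺¹HT` give an infinite chain inducing a chain of full poly-isomorphisms of the `ⁿHT^D`.
* Def 1.4 pp.45–46: distinct `{^{n,m}HT}_{n,m∈ℤ}`; "the vertical arrows are the full log-links, and the
  horizontal arrows are the `Θ^{×μ}`- and `Θ^{×μ}_{gau}`-links of [IUTchII], Corollary 4.10, (iii)"
  [`= the full poly-isomorphism †F^{⊩▶×μ}_{env} ⥲ ‡F^{⊩▶×μ}_△`, resp. `†F^{⊩▶×μ}_{gau} ⥲ ‡F^{⊩▶×μ}_△`,
  IUTchII p.160]; "We shall refer to the log-theta-lattice that involves the `Θ^{×μ}`- (respectively,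
  `Θ^{×μ}_{gau}`-) links as non-Gaussian (respectively, Gaussian)."
* Thm 1.5 p.48: "(i) (Vertical Coricity) The vertical arrows of the Gaussian log-theta-lattice induce
  full poly-isomorphisms between the respective associated `D-Θ^{±ell}NF`-Hodge theaters … (ii)
  (Horizontal Coricity) The horizontal arrows … induce full poly-isomorphisms between the respective
  associated `F^{⊢×μ}`-prime-strips `… ⥲ ^{n,m}F^{⊢×μ}_△ ⥲ ^{n+1,m}F^{⊢×μ}_△ ⥲ …` [cf. [IUTchII],
  Corollary 4.10, (iv)]."

What is a definition / theorem / interface here. DEFINITIONS over the frame: `HTLogLink` (= the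
[poly-]isomorphism `Ξ`; the strip log-links are DERIVED: `stripLogIso`, `stripLink`), `full`,
`LatticeKind`, `LogThetaLatticeDiagram`, `vertical`, `horizontal`. INTERFACE: `ThetaLinkData` = the
`F^{⊩▶×μ}`-prime-strips `†F^{⊩▶×μ}_△ / _{env} / _{gau}` of a Hodge theater and [IUTchII] Cor 4.10 (iv)
(owner abc-iut-L6-t2, TODO-merge). THEOREMS: `stripLogIso_unique` (the "uniquely determines" of
Prop 1.3 (i)), `stripLink_inducedD` (the strip log-links lie over `Ξ` — Prop 1.3 (ii)),
`stripLink_full` (full `Ξ` ⇒ every `†F_□ --log--> ‡F_□` is the full log-link), Thm 1.5 (i)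
`vertical_inducedDHT_full`, Thm 1.5 (ii) `horizontal_inducedFxm_full`. Prop 1.3 (iii) ("properties
corresponding to Prop 1.2 (ii)–(ix) for each `†F_□`") is the conjunction of those items strip by strip and
is not given a separate decl. Deliberately NOT typed (expository Remark sub-items, L6 convention C1):
Rmk 1.3.2 (compatibility with the `F_l^{⋊±}`-symmetrizing isomorphisms of [IUTchII] Cor 4.6 (iii),
"routine details"), Rmk 1.3.3 (i), (ii), Rmk 1.4.1 (i)–(iii) (the lattice squares are "far from being
[1-]commutative"; Fig. 1.3), Rmk 1.4.2 (i), (ii).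
-/

namespace Literature.IUT.LogThetaLattice

open CategoryTheory
open Literature.IUT.HodgeTheaters

universe u

variable {S : StripFrame.{u}}

/-! ### Prop 1.3 (i): the log-link determined by an isomorphism of `D`-Hodge theaters -/

section single

variable (L : LogStripData S) {X Y : S.HT}

/-- **IUTchIII:Prop1.3(i)** (kurims p.42) `D(†F_□) = †D_□`: the identification of the `D`-prime-strip of the strip labelled `□ = l` with the
`D`-prime-strip labelled `l` of the associated `D`-Hodge theater (a component of `strip_comm`). [claim: Mochizuki2012, status: disputed] -/
def stripCommIso (l : S.Label) (X : S.HT) :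
    S.toD.obj ((S.strip l).obj X) ≅ (S.dstrip l).obj (S.htToD.obj X) :=
  (S.strip_comm l).app X

/-- **IUTchIII:Prop1.3(i)** (kurims p.42) The isomorphism of `D`-prime-strips `D(†F_□) ⥲ D(‡F_□)` "determined by `Ξ`" at the label `□ = l`
(`D(†F_□) = †D_□` functorially in the Hodge theater). [claim: Mochizuki2012, status: disputed] -/
def dstripIso (ξ : S.htToD.obj X ≅ S.htToD.obj Y) (l : S.Label) :
    S.toD.obj ((S.strip l).obj X) ≅ S.toD.obj ((S.strip l).obj Y) :=
  stripCommIso l X ≪≫ (S.dstrip l).mapIso ξ ≪≫ (stripCommIso l Y).symm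

/-- **IUTchIII:Prop1.3(i)** (kurims p.42) **Prop 1.3 (i)**: the isomorphism `log(†F_□) ⥲ ‡F_□` "uniquely determine[d]" by `ξ` — the unique
lift [IUTchI, Cor 5.3 (ii)] of `D(log †F_□) = D(†F_□) ⥲ D(‡F_□)`. Constructed for a SINGLE `ξ`
(Rmk 1.3.1). [claim: Mochizuki2012, status: disputed] -/
noncomputable def stripLogIso (ξ : S.htToD.obj X ≅ S.htToD.obj Y) (l : S.Label) :
    L.log.obj ((S.strip l).obj X) ≅ (S.strip l).obj Y :=
  S.liftIso (L.logDIso _ ≪≫ dstripIso ξ l)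

/-- **IUTchIII:Prop1.3(i)** (kurims p.42) `stripLogIso` lies over the `D`-isomorphism determined by `ξ`. [claim: Mochizuki2012, status: disputed] -/
@[simp] theorem mapIso_stripLogIso (ξ : S.htToD.obj X ≅ S.htToD.obj Y) (l : S.Label) :
    S.toD.mapIso (stripLogIso L ξ l) = L.logDIso _ ≪≫ dstripIso ξ l :=
  S.mapIso_liftIso _

/-- **IUTchIII:Prop1.3(i)** (kurims p.42) **"uniquely determines"** (Prop 1.3 (i)): any isomorphism `log(†F_□) ⥲ ‡F_□` lying over the
`D`-isomorphism determined by `ξ` IS `stripLogIso`. [claim: Mochizuki2012, status: disputed] -/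
theorem stripLogIso_unique (ξ : S.htToD.obj X ≅ S.htToD.obj Y) (l : S.Label)
    (φ : L.log.obj ((S.strip l).obj X) ≅ (S.strip l).obj Y)
    (hφ : S.toD.mapIso φ = L.logDIso _ ≪≫ dstripIso ξ l) : φ = stripLogIso L ξ l :=
  S.liftIso_unique _ φ hφ

end single

/-- **IUTchIII:Prop1.3(i)** (kurims p.42) **Prop 1.3 (i): a log-link `†HT --log--> ‡HT` of `Θ^{±ell}NF`-Hodge theaters** — as DATA, the
[poly-]isomorphism `Ξ` of associated `D-Θ^{±ell}NF`-Hodge theaters; the log-links `†F_□ --log--> ‡F_□`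
at all labels `□` are determined by it (`stripLink`). [claim: Mochizuki2012, status: disputed] -/
structure HTLogLink (L : LogStripData S) (X Y : S.HT) where
  /-- the [poly-]isomorphism `Ξ : †HT^{D-Θ±ell NF} ⥲ ‡HT^{D-Θ±ell NF}` -/
  Ξ : PolyIso (S.htToD.obj X) (S.htToD.obj Y)
  /-- a poly-morphism is a nonempty collection -/
  nonempty : Ξ.Nonempty

namespace HTLogLink

variable {L : LogStripData S} {X Y : S.HT}

/-- **IUTchIII:Prop1.3(i)** (kurims p.42) The log-link determined by a single isomorphism `Ξ`. [claim: Mochizuki2012, status: disputed] -/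
def ofIso (L : LogStripData S) (ξ : S.htToD.obj X ≅ S.htToD.obj Y) : HTLogLink L X Y :=
  ⟨PolyIso.single ξ, ⟨ξ, rfl⟩⟩

/-- **IUTchIII:Prop1.3(i)** (kurims p.42) **The full log-link** `†HT --log--> ‡HT` ("When `Ξ` is the full poly-isomorphism"). [claim: Mochizuki2012, status: disputed] -/
def full (L : LogStripData S) (X Y : S.HT) : HTLogLink L X Y :=
  ⟨PolyIso.full _ _, S.full_nonempty_DHT _ _⟩

/-- **IUTchIII:Prop1.3(i)** (kurims p.42) A log-link of Hodge theaters is *full* when `Ξ` is the full poly-isomorphism. [claim: Mochizuki2012, status: disputed] -/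
def IsFull (Λ : HTLogLink L X Y) : Prop := Λ.Ξ = PolyIso.full _ _

/-- **IUTchIII:Prop1.3(i)** (kurims p.42) The full log-link is full. [claim: Mochizuki2012, status: disputed] -/
theorem isFull_full (L : LogStripData S) (X Y : S.HT) : (full L X Y).IsFull := rfl

/-- **IUTchIII:Prop1.3(i)** (kurims p.42) **Prop 1.3 (i)**: the log-link `†F_□ --log--> ‡F_□` at the label `□ = l` belonging to `Λ`: the
poly-isomorphism `log(†F_□) ⥲ ‡F_□` with one constituent `stripLogIso ξ` per constituent `ξ ∈ Ξ`. [claim: Mochizuki2012, status: disputed] -/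
noncomputable def stripLink (Λ : HTLogLink L X Y) (l : S.Label) :
    LogLink L ((S.strip l).obj X) ((S.strip l).obj Y) where
  polyIso := (fun ξ => stripLogIso L ξ l) '' Λ.Ξ
  nonempty := Λ.nonempty.image _

/-- **IUTchIII:Prop1.3(ii)** (kurims p.42) **Prop 1.3 (ii) (Coricity)**: the log-link "induces [and may be thought of as "lying over"]" the
[poly-]isomorphism `Ξ` of `D`-Hodge theaters — by construction it IS `Ξ`. [claim: Mochizuki2012, status: disputed] -/
def inducedDHT (Λ : HTLogLink L X Y) : PolyIso (S.htToD.obj X) (S.htToD.obj Y) := Λ.Ξ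

/-- **IUTchIII:Prop1.3(ii)** (kurims p.42) Prop 1.3 (ii), "and indeed coincides with the log-link constructed in (i) from this
[poly-]isomorphism". [claim: Mochizuki2012, status: disputed] -/
theorem eq_of_inducedDHT (Λ : HTLogLink L X Y) : Λ = ⟨Λ.inducedDHT, Λ.nonempty⟩ := rfl

/-- **IUTchIII:Prop1.3(ii)** (kurims p.42) **Prop 1.3 (ii) at the level of strips**: the `D`-poly-isomorphism `†D_□ ⥲ ‡D_□` induced
(Prop 1.2 (i)) by the strip log-link at `□` is exactly the one determined by `Ξ` — the strip log-links
lie over `Ξ`. [claim: Mochizuki2012, status: disputed] -/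
theorem stripLink_inducedD (Λ : HTLogLink L X Y) (l : S.Label) :
    (Λ.stripLink l).inducedD = (fun ξ => dstripIso ξ l) '' Λ.Ξ := by
  rw [LogLink.inducedD, stripLink, Set.image_image]
  refine Set.image_congr' fun ξ => ?_
  rw [mapIso_stripLogIso, ← Iso.trans_assoc, Iso.symm_self_id, Iso.refl_trans]

/-- **IUTchIII:Prop1.3(i)** (kurims p.42) For the FULL log-link of Hodge theaters, every strip log-link `†F_□ --log--> ‡F_□` is the full
log-link of `F`-prime-strips (every isomorphism `log(†F_□) ⥲ ‡F_□` arises from some `ξ`, since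
`D`-Hodge theaters are related by the full poly-isomorphism and `F`-prime-strips are rigid over
`D`-prime-strips) — PROVIDED every isomorphism of the `D`-prime-strips `†D_□ ⥲ ‡D_□` is induced by an
isomorphism of `D`-Hodge theaters (surjectivity of `dstrip l` on ISOMORPHISMS; stated with that hypothesis
explicit). [claim: Mochizuki2012, status: disputed] -/
theorem stripLink_full (L : LogStripData S) (X Y : S.HT) (l : S.Label)
    (hsurj : Function.Surjective (fun ξ : S.htToD.obj X ≅ S.htToD.obj Y => (S.dstrip l).mapIso ξ)) :
    ((full L X Y).stripLink l).IsFull := by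
  ext φ
  simp only [stripLink, full, PolyIso.full, Set.image_univ, Set.mem_range, Set.mem_univ, iff_true]
  -- the isomorphism `dstrip l (D †HT) ≅ dstrip l (D ‡HT)` that `φ` lies over, lifted to `D`-Hodge theaters
  obtain ⟨ξ, hξ⟩ : ∃ ξ : S.htToD.obj X ≅ S.htToD.obj Y, (S.dstrip l).mapIso ξ =
      (stripCommIso l X).symm ≪≫ (L.logDIso _).symm ≪≫ S.toD.mapIso φ ≪≫ stripCommIso l Y :=
    hsurj _
  refine ⟨ξ, (stripLogIso_unique L ξ l φ ?_).symm⟩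
  rw [dstripIso, hξ]
  simp only [Iso.trans_assoc, Iso.self_symm_id_assoc, Iso.self_symm_id, Iso.trans_refl]

/-! ### Prop 1.3 (iv): the Frobenius-picture of log-linked Hodge theaters -/

/-- **IUTchIII:Prop1.3(iv)** (kurims p.43) **Prop 1.3 (iv), data**: "a collection of distinct `Θ^{±ell}NF`-Hodge theaters … indexed by the
integers". [claim: Mochizuki2012, status: disputed] -/
structure Chain (S : StripFrame.{u}) where
  /-- `n ↦ ⁿHT^{Θ±ell NF}` -/
  HT : ℤ → S.HT
  /-- "distinct" -/
  injective : Function.Injective HT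

/-- **IUTchIII:Prop1.3(iv)** (kurims p.43) The `n`-th arrow of the chain: the full log-link `ⁿHT --log--> ⁿ⁺¹HT`. [claim: Mochizuki2012, status: disputed] -/
def Chain.link (L : LogStripData S) (P : Chain S) (n : ℤ) : HTLogLink L (P.HT n) (P.HT (n + 1)) :=
  full L _ _

/-- **IUTchIII:Prop1.3(iv)** (kurims p.43) **Prop 1.3 (iv)**: the chain "induces a chain of full poly-isomorphisms `… ⥲ ⁿHT^D ⥲ ⁿ⁺¹HT^D ⥲ …`". [claim: Mochizuki2012, status: disputed] -/
theorem Chain.inducedDHT_link (L : LogStripData S) (P : Chain S) (n : ℤ) :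
    (P.link L n).inducedDHT = PolyIso.full _ _ := rfl

end HTLogLink

/-! ### Def 1.4: the log-theta-lattice -/

/-- **IUTchIII:Def1.4** (kurims p.46) The two kinds of horizontal arrow / of log-theta-lattice :
"the log-theta-lattice that involves the `Θ^{×μ}`- (respectively, `Θ^{×μ}_{gau}`-) links [is]
non-Gaussian (respectively, Gaussian)". [claim: Mochizuki2012, status: disputed] -/
inductive LatticeKind : Type
  /-- horizontal arrows are `Θ^{×μ}`-links -/
  | nonGaussian
  /-- horizontal arrows are `Θ^{×μ}_{gau}`-links -/
  | gaussian
  deriving DecidableEq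

/-- **IUTchII:Cor4.10(iii)** (kurims p.160) INTERFACE for the horizontal arrows [IUTchII, Cor 4.10 (i)–(iv) pp.158–160] (owner:
abc-iut-L6-t2, TODO-merge): the `F^{⊩▶×μ}`-prime-strips `†F^{⊩▶×μ}_△` (from the constant prime-strip
`†F^⊩_△`, Cor 4.10 (i)) and `†F^{⊩▶×μ}_{env}`, `†F^{⊩▶×μ}_{gau}` (theta / Gaussian, Cor 4.10 (ii)) attached
functorially to a `Θ^{±ell}NF`-Hodge theater, and Cor 4.10 (iv): "natural isomorphisms
`†F^{⊢×μ}_△ ⥲ †F^{⊢×μ}_{env} ⥲ †F^{⊢×μ}_{gau}`" of associated `F^{⊢×μ}`-prime-strips, such that composing with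
the poly-isomorphism induced by the link "one obtains a poly-isomorphism `†F^{⊢×μ}_△ ⥲ ‡F^{⊢×μ}_△` which
coincides with the full poly-isomorphism". [claim: Mochizuki2012, status: disputed] -/
structure ThetaLinkData (S : StripFrame.{u}) where
  /-- `†HT ↦ †F^{⊩▶×μ}_△` [IUTchII, Cor 4.10 (i), Def 4.9 (viii)] -/
  pilotDelta : S.HT ⥤ S.Fglxm
  /-- `†HT ↦ †F^{⊩▶×μ}_{env}` (kind `nonGaussian`) resp. `†F^{⊩▶×μ}_{gau}` (kind `gaussian`) [IUTchII, Cor 4.10 (ii)] -/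
  pilotTheta : LatticeKind → (S.HT ⥤ S.Fglxm)
  /-- [IUTchII, Cor 4.10 (iv)]: the natural isomorphisms `†F^{⊢×μ}_△ ⥲ †F^{⊢×μ}_{env}`, `⥲ †F^{⊢×μ}_{gau}` -/
  unitPortion : ∀ k : LatticeKind, pilotDelta ⋙ S.FglxmToFxm ≅ pilotTheta k ⋙ S.FglxmToFxm
  /-- [IUTchII, Cor 4.10 (iv)]: the poly-isomorphism of `F^{⊢×μ}`-prime-strips induced by the full
  poly-isomorphism `†F^{⊩▶×μ}_{env/gau} ⥲ ‡F^{⊩▶×μ}_△` "coincides with the full poly-isomorphism" -/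
  induced_full : ∀ (k : LatticeKind) (X Y : S.HT),
    (PolyIso.full ((pilotTheta k).obj X) (pilotDelta.obj Y)).map S.FglxmToFxm = PolyIso.full _ _

namespace ThetaLinkData

variable (T : ThetaLinkData S)

/-- **IUTchII:Cor4.10(iii)** (kurims p.160) **[IUTchII] Cor 4.10 (iii): the `Θ^{×μ}`-link (kind `nonGaussian`) / `Θ^{×μ}_{gau}`-link (kind
`gaussian`) `†HT → ‡HT`** = "the full poly-isomorphism `†F^{⊩▶×μ}_{env} ⥲ ‡F^{⊩▶×μ}_△`" resp.
"`†F^{⊩▶×μ}_{gau} ⥲ ‡F^{⊩▶×μ}_△`". [claim: Mochizuki2012, status: disputed] -/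
def link (k : LatticeKind) (X Y : S.HT) : PolyIso ((T.pilotTheta k).obj X) (T.pilotDelta.obj Y) :=
  PolyIso.full _ _

/-- **IUTchIII:Thm1.5(ii)** (kurims p.48) `†F^{⊢×μ}_△`, the `F^{⊢×μ}`-prime-strip associated to `†F^{⊩▶×μ}_△` [IUTchII, Cor 4.10 (iv)]. [claim: Mochizuki2012, status: disputed] -/
def fxmDelta : S.HT ⥤ S.Fxm := T.pilotDelta ⋙ S.FglxmToFxm

/-- **IUTchII:Cor4.10(iv)** (kurims p.160) **[IUTchII] Cor 4.10 (iv)**: the poly-isomorphism `†F^{⊢×μ}_△ ⥲ ‡F^{⊢×μ}_△` obtained by composing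
the natural isomorphism `†F^{⊢×μ}_△ ⥲ †F^{⊢×μ}_{env/gau}` with the poly-isomorphism induced on
`F^{⊢×μ}`-prime-strips by the link. [claim: Mochizuki2012, status: disputed] -/
def linkInducedFxm (k : LatticeKind) (X Y : S.HT) : PolyIso (T.fxmDelta.obj X) (T.fxmDelta.obj Y) :=
  (PolyIso.single ((T.unitPortion k).app X)).comp ((T.link k X Y).map S.FglxmToFxm)

/-- **IUTchII:Cor4.10(iv)** (kurims p.160) **[IUTchII] Cor 4.10 (iv)**: "… which coincides with the full poly-isomorphism … — that is to
say, "`(−)F^{⊢×μ}_△`" is an invariant of both the `Θ^{×μ}`- and `Θ^{×μ}_{gau}`-links." [claim: Mochizuki2012, status: disputed] -/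
theorem linkInducedFxm_full (k : LatticeKind) (X Y : S.HT) :
    T.linkInducedFxm k X Y = PolyIso.full _ _ := by
  rw [linkInducedFxm, link, T.induced_full]
  exact PolyIso.comp_full_of_nonempty ⟨_, rfl⟩

end ThetaLinkData

/-- **IUTchIII:Def1.4** (kurims p.45) **Def 1.4: a log-theta-lattice** : "a collection of distinct
`Θ^{±ell}NF`-Hodge theaters … indexed by pairs of integers" `{^{n,m}HT}`, of a given KIND
(non-Gaussian: horizontal arrows are `Θ^{×μ}`-links; Gaussian: `Θ^{×μ}_{gau}`-links); the vertical arrow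
`(n,m) → (n,m+1)` is the full log-link, the horizontal arrow `(n,m) → (n+1,m)` the link of [IUTchII]
Cor 4.10 (iii) — both FULL poly-isomorphisms, hence no further data (index conventions as in
`LatticeArrow` of `FrobeniusPicture.lean`). [claim: Mochizuki2012, status: disputed] -/
structure LogThetaLatticeDiagram (L : LogStripData S) (T : ThetaLinkData S) where
  /-- non-Gaussian (`Θ^{×μ}`) or Gaussian (`Θ^{×μ}_{gau}`) -/
  kind : LatticeKind
  /-- `(n, m) ↦ ^{n,m}HT^{Θ±ell NF}` -/
  HT : ℤ × ℤ → S.HT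
  /-- "distinct" -/
  injective : Function.Injective HT

namespace LogThetaLatticeDiagram

variable {L : LogStripData S} {T : ThetaLinkData S} (Λ : LogThetaLatticeDiagram L T)

/-- **IUTchIII:Def1.4** (kurims p.46) "Gaussian" log-theta-lattice . [claim: Mochizuki2012, status: disputed] -/
def IsGaussian : Prop := Λ.kind = LatticeKind.gaussian

/-- **IUTchIII:Def1.4** (kurims p.45) **The vertical arrow** `^{n,m}HT --log--> ^{n,m+1}HT`: the full log-link. [claim: Mochizuki2012, status: disputed] -/
def vertical (n m : ℤ) : HTLogLink L (Λ.HT (n, m)) (Λ.HT (n, m + 1)) := HTLogLink.full L _ _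

/-- **IUTchIII:Def1.4** (kurims p.45) **The horizontal arrow** `^{n,m}HT → ^{n+1,m}HT`: the `Θ^{×μ}`- resp. `Θ^{×μ}_{gau}`-link, i.e. the
full poly-isomorphism `^{n,m}F^{⊩▶×μ}_{env/gau} ⥲ ^{n+1,m}F^{⊩▶×μ}_△`. [claim: Mochizuki2012, status: disputed] -/
def horizontal (n m : ℤ) :
    PolyIso ((T.pilotTheta Λ.kind).obj (Λ.HT (n, m))) (T.pilotDelta.obj (Λ.HT (n + 1, m))) :=
  T.link Λ.kind _ _

/-- **IUTchIII:Def1.4** (kurims p.45) Every vertical arrow is a full log-link. [claim: Mochizuki2012, status: disputed] -/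
theorem vertical_isFull (n m : ℤ) : (Λ.vertical n m).IsFull := rfl

/-- **IUTchIII:Def1.4** (kurims p.45) Every horizontal arrow is the full poly-isomorphism. [claim: Mochizuki2012, status: disputed] -/
theorem horizontal_eq_full (n m : ℤ) : Λ.horizontal n m = PolyIso.full _ _ := rfl

/-! ### Thm 1.5 (i), (ii): vertical and horizontal coricity -/

/-- **IUTchIII:Thm1.5(i)** (kurims p.48) **Thm 1.5 (i) (Vertical Coricity)**: "The vertical arrows of the Gaussian log-theta-lattice induce
full poly-isomorphisms between the respective associated `D-Θ^{±ell}NF`-Hodge theaters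
`… ⥲ ^{n,m}HT^D ⥲ ^{n,m+1}HT^D ⥲ …`" (holds for either kind). [claim: Mochizuki2012, status: disputed] -/
theorem vertical_inducedDHT_full (n m : ℤ) : (Λ.vertical n m).inducedDHT = PolyIso.full _ _ := rfl

/-- **IUTchIII:Thm1.5(ii)** (kurims p.48) The `F^{⊢×μ}`-prime-strip `^{n,m}F^{⊢×μ}_△` of the lattice. [claim: Mochizuki2012, status: disputed] -/
def fxmDelta (p : ℤ × ℤ) : S.Fxm := T.fxmDelta.obj (Λ.HT p)

/-- **IUTchIII:Thm1.5(ii)** (kurims p.48) **Thm 1.5 (ii) (Horizontal Coricity)**: "The horizontal arrows … induce full poly-isomorphisms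
between the respective associated `F^{⊢×μ}`-prime-strips `… ⥲ ^{n,m}F^{⊢×μ}_△ ⥲ ^{n+1,m}F^{⊢×μ}_△ ⥲ …`
[cf. [IUTchII], Corollary 4.10, (iv)]." [claim: Mochizuki2012, status: disputed] -/
theorem horizontal_inducedFxm_full (n m : ℤ) :
    T.linkInducedFxm Λ.kind (Λ.HT (n, m)) (Λ.HT (n + 1, m))
      = PolyIso.full (Λ.fxmDelta (n, m)) (Λ.fxmDelta (n + 1, m)) :=
  T.linkInducedFxm_full _ _ _

/-- **IUTchIII:Thm1.5(i)** (kurims p.48) The vertical line `n` of the lattice is a Frobenius-picture chain of Hodge theaters (Prop 1.3 (iv)). [claim: Mochizuki2012, status: disputed] -/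
def verticalChain (n : ℤ) : HTLogLink.Chain S where
  HT m := Λ.HT (n, m)
  injective := fun m m' h => by simpa using Λ.injective h

end LogThetaLatticeDiagram

end Literature.IUT.LogThetaLattice
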